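import Literature.AnabelianGeometry.SemiGraphs.PSCSeparatingCoveringsTwoNodeCycle
import Literature.AnabelianGeometry.SemiGraphs.PSCSeparatingCoveringsTwoComponentAffineOrigin
import HarnessLib

/-!
# [CombGC] Prop. 1.2, proof p. 9: EDGE-LIKE separating coverings at the TWO-NODE-CYCLE shape (row F-2827)

Mochizuki, *A combinatorial version of the Grothendieck conjecture*, Tohoku Math. J. **59** (2007)
[CombGC], PROOF of Proposition 1.2, author's manuscript p. 9, resp'd (edge) case.  Companion of
`PSCSeparatingCoveringsTwoNodeCycle.lean` (F-2826 at the same shape): the pointed stable curve with TWO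
irreducible components `v₀` (genus `m ≥ 1`, cusps `c_s, …, c_{r'}`) and `v₁` (genus `g - m - 1 ≥ 1`,
cusps `c_0, …, c_{s-1}`, `s ≥ 1`) joined by TWO nodes — dual graph a `2`-cycle, `Π_G ≅` the pro-`Σ`
completion of `Γ_{g,r'+1}`; node groups the closures of `⟨b_m⟩` and `⟨δ⟩`,
`δ = (c_0⋯c_{s-1})⁻¹ ([a_{m+1},b_{m+1}]⋯[a_{g-1},b_{g-1}])⁻¹ b_m`, cusp groups the closures of `⟨c_j⟩`.

* `edgeLikeSeparatingCoverings_of_twoNodeCycle` — F-2827 (`EdgeLikeSeparatingCoverings`, `V' := V`):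
  f-166's rank-one engine `edgeLikeSeparatingCoverings_of_rankOneFreeFactors`; every edge generator is
  a member of a free basis (`b_m`, `c_j` letters of the cusp-eliminating bases, `δ` by
  `exists_freeGroupBasis_cycleNode₂`), and the separating homomorphisms to `D₃` are letter assignments
  on the `c_0`-eliminating basis, balanced against the evaluations
  `χ(c_0) = [χ a_m, χ b_m]⁻¹ χ(c_{j₀})⁻¹`, `χ(δ) = χ(c_0⋯c_{s-1})⁻¹ χ(b_m)` (all `a`-letters trivial).
* `separatingCoverings_of_twoNodeCycle_of_unr`, `prop12_of_twoNodeCycle_of_unr` — F-2829 and Prop. 1.2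
  (i)+(ii) from the above, F-2826 (companion file) and an F-2828 witness supplied as a hypothesis;
  `prop12_of_twoNodeCycle_of_not_isSturdy` — hypothesis-free when a component has genus `≤ 1`
  (`unrVerticialSeparatingCoverings_of_not_isSturdy`).
Theorems only, no new declarations of facts.
-/

namespace Literature.AnabelianGeometry.SemiGraphs

open scoped Pointwise
open Literature.GroupTheory.CombinatorialGroupTheory
open Literature.GroupTheory.CombinatorialGroupTheory.PuncturedSurfaceGroup
open Literature.GroupTheory.CombinatorialGroupTheory.FreeFactorFibredTwist (lift_apply_basis)
open SemiGraphOfAnabelioids (IsProSigmaCompletion)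

namespace PSCDatum

section Datum

variable {P : Type} [Group P] [TopologicalSpace P] [IsTopologicalGroup P]
variable [CompactSpace P] [TotallyDisconnectedSpace P] {Sigma : Set ℕ} {g r : ℕ}

/-- **F-2827 / row P12-L01-E (`EdgeLikeSeparatingCoverings`, `V' := V`) at EVERY datum of
two-node-cycle shape** (components of genera `m ≥ 1` and `g - m - 1 ≥ 1`, the second carrying the cusps
`c_0, …, c_{s-1}`, `1 ≤ s ≤ r'`).  Separating homomorphisms to `D₃` by letter assignment on the
`c_0`-eliminating basis. [cite: MochizukiCombGC2007, Prop 1.2 proof p.9] -/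
theorem edgeLikeSeparatingCoverings_of_twoNodeCycle (hne : Sigma.Nonempty)
    (hprime : ∀ p ∈ Sigma, p.Prime) (ι : PuncturedSurfaceGroup g r →* P)
    (hι : IsProSigmaCompletion Sigma ι) (G : PSCDatum P) {m s : ℕ} (hm : m + 2 ≤ g)
    (hs1 : 1 ≤ s) (hsr : s + 1 ≤ r)
    (e : G.graph.C ≃ Fin r)
    (hC : ∀ c', G.cuspGp c' = ((cuspInertia (g := g) (e c')).map ι).topologicalClosure)
    (n₁ n₂ : G.graph.N) (hN : ∀ n, n = n₁ ∨ n = n₂) (δ : PuncturedSurfaceGroup g r)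
    (hδ : δ = (((List.finRange r).map fun j : Fin r =>
        if (j : ℕ) < s then PuncturedSurfaceGroup.c (g := g) j else 1).prod)⁻¹ *
      (((List.finRange g).map fun i : Fin g => if m + 1 ≤ (i : ℕ) then
        PuncturedSurfaceGroup.a (r := r) i * PuncturedSurfaceGroup.b i *
          (PuncturedSurfaceGroup.a i)⁻¹ * (PuncturedSurfaceGroup.b i)⁻¹ else 1).prod)⁻¹ *
      PuncturedSurfaceGroup.b ⟨m, by omega⟩)
    (hE₁ : G.nodeGp n₁ = ((Subgroup.zpowers (PuncturedSurfaceGroup.b (r := r) ⟨m, by omega⟩)).map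
      ι).topologicalClosure)
    (hE₂ : G.nodeGp n₂ = ((Subgroup.zpowers δ).map ι).topologicalClosure) :
    G.EdgeLikeSeparatingCoverings := by
  classical
  obtain ⟨r', rfl⟩ : ∃ r', r = r' + 1 := ⟨r - 1, by omega⟩
  have hr' : 1 ≤ r' := by omega
  obtain ⟨b₀, ha, hb, hc⟩ := exists_freeGroupBasis_elim_zero g r'
  obtain ⟨bN, hbN⟩ := exists_freeGroupBasis_cycleNode₂ g r' m s (by omega) (by omega) δ hδ
  set km : Fin g := ⟨m, by omega⟩ with hkm
  set jL : Fin r' := ⟨r' - 1, by omega⟩ with hjL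
  have hjLs : ¬ ((jL : ℕ) + 1 < s) := by simp [jL]; omega
  -- edge generators
  let xs : G.graph.N ⊕ G.graph.C → PuncturedSurfaceGroup g (r' + 1) :=
    Sum.elim (fun n => if n = n₁ then PuncturedSurfaceGroup.b km else δ) (fun c' => c (e c'))
  have hxs₁ : ∀ n, n = n₁ → xs (Sum.inl n) = PuncturedSurfaceGroup.b km := fun n hn => by simp [xs, hn]
  have hxs₂ : ∀ n, n ≠ n₁ → xs (Sum.inl n) = δ := fun n hn => by simp [xs, hn]
  have hxsC : ∀ c', xs (Sum.inr c') = c (e c') := fun _ => rfl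
  have hx : ∀ ed, G.edgeGp ed = ((Subgroup.zpowers (xs ed)).map ι).topologicalClosure := by
    rintro (n | c')
    · by_cases hn : n = n₁
      · rw [hxs₁ n hn]; subst hn; exact hE₁
      · rw [hxs₂ n hn]
        obtain rfl := (hN n).resolve_left hn
        exact hE₂
    · exact hC c'
  have hfac : ∀ ed, ∃ (κ : Type) (bκ : FreeGroupBasis κ (PuncturedSurfaceGroup g (r' + 1))) (κ₀ : κ),
      bκ κ₀ = xs ed := by
    rintro (n | c')
    · by_cases hn : n = n₁
      · exact ⟨_, b₀, Sum.inl (km, true), by rw [hxs₁ n hn]; exact hb _⟩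
      · exact ⟨_, bN, Sum.inl (km, true), by rw [hxs₂ n hn]; exact hbN⟩
    · exact exists_freeGroupBasis_eq_c (by omega) (e c')
  -- the dihedral values
  let x : DihedralGroup 3 := DihedralGroup.r 2
  let u : DihedralGroup 3 := DihedralGroup.sr 0
  let v : DihedralGroup 3 := DihedralGroup.sr 1
  have hx1 : x ≠ 1 := by decide
  have hvu : (v * u * v⁻¹ * u⁻¹)⁻¹ * (1 : DihedralGroup 3)⁻¹ ≠ 1 := by decide
  have hvux : (v * u * v⁻¹ * u⁻¹)⁻¹ * x⁻¹ = 1 := by decide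
  -- evaluation of letter homomorphisms
  have hχa : ∀ (f : (Fin g × Bool) ⊕ Fin r' → DihedralGroup 3) (i : Fin g),
      b₀.lift f (PuncturedSurfaceGroup.a i) = f (Sum.inl (i, false)) := fun f i => by
    rw [← ha, lift_apply_basis]
  have hχb : ∀ (f : (Fin g × Bool) ⊕ Fin r' → DihedralGroup 3) (i : Fin g),
      b₀.lift f (PuncturedSurfaceGroup.b i) = f (Sum.inl (i, true)) := fun f i => by
    rw [← hb, lift_apply_basis]
  have hχc : ∀ (f : (Fin g × Bool) ⊕ Fin r' → DihedralGroup 3) (j : Fin (r' + 1)) (hj : j ≠ 0),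
      b₀.lift f (c j) = f (Sum.inr (j.pred hj)) := fun f j hj => by
    conv_lhs => rw [← Fin.succ_pred j hj, ← hc, lift_apply_basis]
  have hc0 : ∀ (f : (Fin g × Bool) ⊕ Fin r' → DihedralGroup 3) (j : Fin (r' + 1)) (_ : j = 0)
      (i₀ : Fin g) (j₀ : Fin r'),
      (∀ i, i ≠ i₀ → f (Sum.inl (i, false)) = 1) → (∀ j, j ≠ j₀ → f (Sum.inr j) = 1) →
      b₀.lift f (c j) = (f (Sum.inl (i₀, false)) * f (Sum.inl (i₀, true)) * (f (Sum.inl (i₀, false)))⁻¹ *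
          (f (Sum.inl (i₀, true)))⁻¹)⁻¹ * (f (Sum.inr j₀))⁻¹ := by
    intro f j hj i₀ j₀ hfa hfc
    have : j = ⟨0, Nat.succ_pos r'⟩ := Fin.ext (by rw [hj]; rfl)
    rw [this]
    exact map_lift_c_zero ha hb hc f i₀ j₀ hfa hfc
  -- `χ(c_0)` and `χ(δ)` when ALL `a`-letters are trivial and at most the cusp letter `j₀` is not
  have hc0' : ∀ (f : (Fin g × Bool) ⊕ Fin r' → DihedralGroup 3) (j : Fin (r' + 1)) (_ : j = 0)
      (j₀ : Fin r'), (∀ i, f (Sum.inl (i, false)) = 1) → (∀ j, j ≠ j₀ → f (Sum.inr j) = 1) →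
      b₀.lift f (c j) = (f (Sum.inr j₀))⁻¹ := by
    intro f j hj j₀ hfa hfc
    rw [hc0 f j hj km j₀ (fun i _ => hfa i) hfc, hfa]
    group
  have hδv : ∀ (f : (Fin g × Bool) ⊕ Fin r' → DihedralGroup 3) (j₀ : Fin r'),
      (∀ i, f (Sum.inl (i, false)) = 1) → (∀ j, j ≠ j₀ → f (Sum.inr j) = 1) →
      b₀.lift f δ = ((f (Sum.inr j₀))⁻¹ * (if (j₀ : ℕ) + 1 < s then f (Sum.inr j₀) else 1))⁻¹ *
        f (Sum.inl (km, true)) := by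
    intro f j₀ hfa hfc
    have hXr : b₀.lift f (((List.finRange g).map fun i : Fin g => if m + 1 ≤ (i : ℕ) then
        PuncturedSurfaceGroup.a (r := r' + 1) i * PuncturedSurfaceGroup.b i *
          (PuncturedSurfaceGroup.a i)⁻¹ * (PuncturedSurfaceGroup.b i)⁻¹ else 1).prod) = 1 := by
      rw [map_prod_map_finRange_ite]
      refine List.prod_eq_one fun y hy => ?_
      rw [List.mem_map] at hy
      obtain ⟨i, _, rfl⟩ := hy
      split_ifs
      · rw [map_mul, map_mul, map_mul, map_inv, map_inv, hχa, hfa]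
        group
      · rfl
    have hCl : b₀.lift f (((List.finRange (r' + 1)).map fun j : Fin (r' + 1) =>
        if (j : ℕ) < s then c (g := g) j else 1).prod) =
        (f (Sum.inr j₀))⁻¹ * (if (j₀ : ℕ) + 1 < s then f (Sum.inr j₀) else 1) := by
      rw [cusp_prod_lt_eq_c_zero_mul s (by omega) (Nat.succ_pos r'), map_mul,
        hc0' f ⟨0, Nat.succ_pos r'⟩ (Fin.ext (by rw [Fin.val_zero])) j₀ hfa hfc, map_prod_map_finRange_ite,
        prod_map_finRange_ite_eq_of_single (r' + 1) _ _ j₀.succ]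
      · congr 1
        by_cases hlt : (j₀ : ℕ) + 1 < s
        · rw [if_pos hlt, if_pos ⟨by simp, by simpa using hlt⟩, hχc f _ (Fin.succ_ne_zero _)]
          simp only [Fin.pred_succ]
        · rw [if_neg hlt, if_neg (by simp only [Fin.val_succ]; omega)]
      · intro j hj hp
        have hj0 : j ≠ 0 := fun h => by simp [h] at hp
        rw [hχc f j hj0, hfc]
        intro h
        exact hj (by rw [← Fin.succ_pred j hj0, h])
    rw [hδ, map_mul, map_mul, map_inv, map_inv, hXr, hCl, hχb, inv_one, mul_one]
  refine G.edgeLikeSeparatingCoverings_of_rankOneFreeFactors hι ⟨hne.some, hne.some_mem, hprime _ hne.some_mem⟩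
    xs hx hfac (M := DihedralGroup 3) ?_
  rintro (n | c₁) (n' | c₂) hne12
  · -- node alive, node killed
    by_cases h1 : n = n₁
    · -- alive `b_m`, killed `δ`: `b_m ↦ x`, `c_{r'} ↦ x⁻¹`
      have h2 : n' ≠ n₁ := fun h => hne12 (by rw [h1, h])
      rw [hxs₂ n' h2, hxs₁ n h1]
      refine ⟨b₀.lift fun y => if y = Sum.inl (km, true) then x
          else if y = Sum.inr jL then x⁻¹ else 1, ?_, ?_⟩
      · rw [hδv _ jL (fun i => by rw [if_neg (by simp), if_neg (by simp)])
            (fun j hj => by rw [if_neg (by simp), if_neg (by simpa using hj)]),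
          if_neg hjLs, if_neg (by simp), if_pos rfl, if_pos rfl]
        decide
      · rw [hχb, if_pos rfl]
        exact hx1
    · -- alive `δ`, killed `b_m`: `c_{r'} ↦ x`
      have h2 : n' = n₁ := by
        rcases hN n' with h | h
        · exact h
        · exfalso
          rcases hN n with h' | h'
          · exact h1 h'
          · exact hne12 (by rw [h', h])
      rw [hxs₁ n' h2, hxs₂ n h1]
      refine ⟨b₀.lift fun y => if y = Sum.inr jL then x else 1, ?_, ?_⟩
      · rw [hχb, if_neg (by simp)]
      · rw [hδv _ jL (fun i => if_neg (by simp)) (fun j hj => if_neg (by simpa using hj)),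
          if_neg hjLs, if_pos rfl, if_neg (by simp)]
        decide
  · -- node alive, cusp killed: `b_m ↦ x` (then `χ(b_m) = χ(δ) = x`, every `χ(c_j) = 1`)
    refine ⟨b₀.lift fun y => if y = Sum.inl (km, true) then x else 1, ?_, ?_⟩
    · change b₀.lift _ (c (e c₂)) = 1
      by_cases hj : e c₂ = 0
      · rw [hc0' _ _ hj jL (fun i => if_neg (by simp)) (fun j _ => if_neg (by simp)), if_neg (by simp),
          inv_one]
      · rw [hχc _ _ hj, if_neg (by simp)]
    · by_cases h1 : n = n₁
      · rw [hxs₁ n h1, hχb, if_pos rfl]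
        exact hx1
      · rw [hxs₂ n h1, hδv _ jL (fun i => if_neg (by simp)) (fun j _ => if_neg (by simp)),
          if_neg hjLs, if_neg (by simp), if_pos rfl]
        decide
  · -- cusp alive, node killed
    change ∃ χ : PuncturedSurfaceGroup g (r' + 1) →* DihedralGroup 3, χ (xs (Sum.inl n')) = 1 ∧ χ (c (e c₁)) ≠ 1
    by_cases h1 : n' = n₁
    · -- killed `b_m`
      rw [hxs₁ n' h1]
      by_cases hj : e c₁ = 0
      · refine ⟨b₀.lift fun y => if y = Sum.inr jL then x⁻¹ else 1, ?_, ?_⟩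
        · rw [hχb, if_neg (by simp)]
        · rw [hc0' _ _ hj jL (fun i => if_neg (by simp)) (fun j hj' => if_neg (by simpa using hj')),
            if_pos rfl, inv_inv]
          exact hx1
      · refine ⟨b₀.lift fun y => if y = Sum.inr ((e c₁).pred hj) then x else 1, ?_, ?_⟩
        · rw [hχb, if_neg (by simp)]
        · rw [hχc _ _ hj, if_pos rfl]
          exact hx1
    · -- killed `δ`
      rw [hxs₂ n' h1]
      by_cases hj : e c₁ = 0
      · -- alive `c_0`: `c_{r'} ↦ x⁻¹`, `b_m ↦ x`
        refine ⟨b₀.lift fun y => if y = Sum.inr jL then x⁻¹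
            else if y = Sum.inl (km, true) then x else 1, ?_, ?_⟩
        · rw [hδv _ jL (fun i => by rw [if_neg (by simp), if_neg (by simp)])
              (fun j hj' => by rw [if_neg (by simpa using hj'), if_neg (by simp)]),
            if_neg hjLs, if_pos rfl, if_neg (by simp), if_pos rfl]
          decide
        · rw [hc0' _ _ hj jL (fun i => by rw [if_neg (by simp), if_neg (by simp)])
              (fun j hj' => by rw [if_neg (by simpa using hj'), if_neg (by simp)]),
            if_pos rfl, inv_inv]
          exact hx1
      · by_cases hlt : ((e c₁ : Fin (r' + 1)) : ℕ) < s
        · -- alive `c_j`, `1 ≤ j < s`: its letter `↦ x` (`χ(c_0) = x⁻¹` balances `χ(δ)`)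
          refine ⟨b₀.lift fun y => if y = Sum.inr ((e c₁).pred hj) then x else 1, ?_, ?_⟩
          · have hlt' : (((e c₁).pred hj : Fin r') : ℕ) + 1 < s := by
              have h0 : ((e c₁ : Fin (r' + 1)) : ℕ) ≠ 0 := fun h => hj (Fin.ext (by rw [h, Fin.val_zero]))
              have := Fin.val_pred (e c₁) hj
              omega
            rw [hδv _ ((e c₁).pred hj) (fun i => if_neg (by simp)) (fun j hj' => if_neg (by simpa using hj')),
              if_pos hlt', if_pos rfl, if_neg (by simp)]
            group
          · rw [hχc _ _ hj, if_pos rfl]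
            exact hx1
        · -- alive `c_j`, `s ≤ j`: its letter `↦ x`, `b_m ↦ x⁻¹`
          refine ⟨b₀.lift fun y => if y = Sum.inr ((e c₁).pred hj) then x
              else if y = Sum.inl (km, true) then x⁻¹ else 1, ?_, ?_⟩
          · have hlt' : ¬ ((((e c₁).pred hj : Fin r') : ℕ) + 1 < s) := by
              have := Fin.val_pred (e c₁) hj
              omega
            rw [hδv _ ((e c₁).pred hj) (fun i => by rw [if_neg (by simp), if_neg (by simp)])
                (fun j hj' => by rw [if_neg (by simpa using hj'), if_neg (by simp)]),
              if_neg hlt', if_pos rfl, if_neg (by simp), if_pos rfl]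
            group
          · rw [hχc _ _ hj, if_pos rfl]
            exact hx1
  · -- cusp alive, cusp killed (as at irreducible multi-nodal data, handle `0`)
    have hg : 1 ≤ g := by omega
    change ∃ χ : PuncturedSurfaceGroup g (r' + 1) →* DihedralGroup 3, χ (c (e c₂)) = 1 ∧ χ (c (e c₁)) ≠ 1
    have hj12 : e c₁ ≠ e c₂ := fun h => hne12 (by rw [e.injective h])
    by_cases hj₁ : e c₁ = 0
    · have hj₂ : e c₂ ≠ 0 := fun h => hj12 (hj₁.trans h.symm)
      refine ⟨b₀.lift fun y => if y = Sum.inl (⟨0, hg⟩, false) then v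
          else if y = Sum.inl (⟨0, hg⟩, true) then u else 1, ?_, ?_⟩
      · rw [hχc _ _ hj₂, if_neg (by simp), if_neg (by simp)]
      · rw [hc0 _ _ hj₁ ⟨0, hg⟩ ⟨0, hr'⟩ (fun i hi => by rw [if_neg (by simpa using hi), if_neg (by simp)])
            (fun j _ => by rw [if_neg (by simp), if_neg (by simp)]),
          if_pos rfl, if_neg (by simp), if_pos rfl, if_neg (by simp), if_neg (by simp)]
        exact hvu
    · by_cases hj₂ : e c₂ = 0
      · refine ⟨b₀.lift fun y => if y = Sum.inr ((e c₁).pred hj₁) then x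
            else if y = Sum.inl (⟨0, hg⟩, false) then v
            else if y = Sum.inl (⟨0, hg⟩, true) then u else 1, ?_, ?_⟩
        · rw [hc0 _ _ hj₂ ⟨0, hg⟩ ((e c₁).pred hj₁)
              (fun i hi => by rw [if_neg (by simp), if_neg (by simpa using hi), if_neg (by simp)])
              (fun j hj' => by rw [if_neg (by simpa using hj'), if_neg (by simp), if_neg (by simp)]),
            if_neg (by simp), if_pos rfl, if_neg (by simp), if_neg (by simp), if_pos rfl, if_pos rfl]
          exact hvux
        · rw [hχc _ _ hj₁, if_pos rfl]
          exact hx1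
      · refine ⟨b₀.lift fun y => if y = Sum.inr ((e c₁).pred hj₁) then x else 1, ?_, ?_⟩
        · rw [hχc _ _ hj₂, if_neg]
          intro h
          apply hj12
          have h' := (Sum.inr.inj h)
          rw [← Fin.succ_pred (e c₂) hj₂, ← Fin.succ_pred (e c₁) hj₁, h']
        · rw [hχc _ _ hj₁, if_pos rfl]
          exact hx1

/-- **F-2829 (`SeparatingCoverings`) at EVERY two-node-cycle datum, modulo the unramified conjunct F-2828**
(supplied as `hU`; it is vacuous — `unrVerticialSeparatingCoverings_of_not_isSturdy` — as soon as one
component has genus `≤ 1`): F-2826 (`verticialSeparatingCoverings_of_twoNodeCycle`, companion file) and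
F-2827 (above). [cite: MochizukiCombGC2007, Prop 1.2 proof p.9] -/
theorem separatingCoverings_of_twoNodeCycle_of_unr (hne : Sigma.Nonempty)
    (hprime : ∀ p ∈ Sigma, p.Prime) (ι : PuncturedSurfaceGroup g r →* P)
    (hι : IsProSigmaCompletion Sigma ι) (G : PSCDatum P) {m s : ℕ} (hm : m + 2 ≤ g) (hm1 : 1 ≤ m)
    (hs1 : 1 ≤ s) (hsr : s + 1 ≤ r)
    (e : G.graph.C ≃ Fin r)
    (hC : ∀ c', G.cuspGp c' = ((cuspInertia (g := g) (e c')).map ι).topologicalClosure)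
    (v₀ v₁ : G.graph.V) (hV : ∀ w, w = v₀ ∨ w = v₁)
    (n₁ n₂ : G.graph.N) (hN : ∀ n, n = n₁ ∨ n = n₂) (δ : PuncturedSurfaceGroup g r)
    (hδ : δ = (((List.finRange r).map fun j : Fin r =>
        if (j : ℕ) < s then PuncturedSurfaceGroup.c (g := g) j else 1).prod)⁻¹ *
      (((List.finRange g).map fun i : Fin g => if m + 1 ≤ (i : ℕ) then
        PuncturedSurfaceGroup.a (r := r) i * PuncturedSurfaceGroup.b i *
          (PuncturedSurfaceGroup.a i)⁻¹ * (PuncturedSurfaceGroup.b i)⁻¹ else 1).prod)⁻¹ *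
      PuncturedSurfaceGroup.b ⟨m, by omega⟩)
    (hV₀ : G.vertGp v₀ = ((Subgroup.closure {x : PuncturedSurfaceGroup g r |
        (∃ i : Fin g, (i : ℕ) < m ∧ (x = PuncturedSurfaceGroup.a i ∨ x = PuncturedSurfaceGroup.b i)) ∨
        (∃ j : Fin r, s ≤ (j : ℕ) ∧ x = PuncturedSurfaceGroup.c j) ∨
        x = PuncturedSurfaceGroup.a ⟨m, by omega⟩ * PuncturedSurfaceGroup.b ⟨m, by omega⟩ *
          (PuncturedSurfaceGroup.a ⟨m, by omega⟩)⁻¹ ∨ x = δ}).map ι).topologicalClosure)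
    (hV₁ : G.vertGp v₁ = ((Subgroup.closure {x : PuncturedSurfaceGroup g r |
        (∃ i : Fin g, m < (i : ℕ) ∧ (x = PuncturedSurfaceGroup.a i ∨ x = PuncturedSurfaceGroup.b i)) ∨
        (∃ j : Fin r, (j : ℕ) < s ∧ x = PuncturedSurfaceGroup.c j) ∨
        x = PuncturedSurfaceGroup.b ⟨m, by omega⟩ ∨ x = δ}).map ι).topologicalClosure)
    (hE₁ : G.nodeGp n₁ = ((Subgroup.zpowers (PuncturedSurfaceGroup.b (r := r) ⟨m, by omega⟩)).map
      ι).topologicalClosure)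
    (hE₂ : G.nodeGp n₂ = ((Subgroup.zpowers δ).map ι).topologicalClosure)
    (hU : G.UnrVerticialSeparatingCoverings) :
    G.SeparatingCoverings :=
  ⟨G.verticialSeparatingCoverings_of_twoNodeCycle hne hprime ι hι hm hm1 hs1 hsr v₀ v₁ hV δ hδ hV₀ hV₁,
    G.edgeLikeSeparatingCoverings_of_twoNodeCycle hne hprime ι hι hm hs1 hsr e hC n₁ n₂ hN δ hδ hE₁ hE₂, hU⟩

/-- **[CombGC] Prop. 1.2 (i) and (ii) at EVERY two-node-cycle datum, modulo F-2828** (`hU`, vacuous at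
non-sturdy data): w5-d183's `prop12_of_separating` on F-2829 above — F-0459 (all three cases) and F-0438
(BOTH clauses) at the first dual graph with a cycle. [cite: MochizukiCombGC2007, Prop 1.2 pp.8-9] -/
theorem prop12_of_twoNodeCycle_of_unr (hne : Sigma.Nonempty)
    (hprime : ∀ p ∈ Sigma, p.Prime) (ι : PuncturedSurfaceGroup g r →* P)
    (hι : IsProSigmaCompletion Sigma ι) (G : PSCDatum P) {m s : ℕ} (hm : m + 2 ≤ g) (hm1 : 1 ≤ m)
    (hs1 : 1 ≤ s) (hsr : s + 1 ≤ r)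
    (e : G.graph.C ≃ Fin r)
    (hC : ∀ c', G.cuspGp c' = ((cuspInertia (g := g) (e c')).map ι).topologicalClosure)
    (v₀ v₁ : G.graph.V) (hV : ∀ w, w = v₀ ∨ w = v₁)
    (n₁ n₂ : G.graph.N) (hN : ∀ n, n = n₁ ∨ n = n₂) (δ : PuncturedSurfaceGroup g r)
    (hδ : δ = (((List.finRange r).map fun j : Fin r =>
        if (j : ℕ) < s then PuncturedSurfaceGroup.c (g := g) j else 1).prod)⁻¹ *
      (((List.finRange g).map fun i : Fin g => if m + 1 ≤ (i : ℕ) then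
        PuncturedSurfaceGroup.a (r := r) i * PuncturedSurfaceGroup.b i *
          (PuncturedSurfaceGroup.a i)⁻¹ * (PuncturedSurfaceGroup.b i)⁻¹ else 1).prod)⁻¹ *
      PuncturedSurfaceGroup.b ⟨m, by omega⟩)
    (hV₀ : G.vertGp v₀ = ((Subgroup.closure {x : PuncturedSurfaceGroup g r |
        (∃ i : Fin g, (i : ℕ) < m ∧ (x = PuncturedSurfaceGroup.a i ∨ x = PuncturedSurfaceGroup.b i)) ∨
        (∃ j : Fin r, s ≤ (j : ℕ) ∧ x = PuncturedSurfaceGroup.c j) ∨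
        x = PuncturedSurfaceGroup.a ⟨m, by omega⟩ * PuncturedSurfaceGroup.b ⟨m, by omega⟩ *
          (PuncturedSurfaceGroup.a ⟨m, by omega⟩)⁻¹ ∨ x = δ}).map ι).topologicalClosure)
    (hV₁ : G.vertGp v₁ = ((Subgroup.closure {x : PuncturedSurfaceGroup g r |
        (∃ i : Fin g, m < (i : ℕ) ∧ (x = PuncturedSurfaceGroup.a i ∨ x = PuncturedSurfaceGroup.b i)) ∨
        (∃ j : Fin r, (j : ℕ) < s ∧ x = PuncturedSurfaceGroup.c j) ∨
        x = PuncturedSurfaceGroup.b ⟨m, by omega⟩ ∨ x = δ}).map ι).topologicalClosure)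
    (hE₁ : G.nodeGp n₁ = ((Subgroup.zpowers (PuncturedSurfaceGroup.b (r := r) ⟨m, by omega⟩)).map
      ι).topologicalClosure)
    (hE₂ : G.nodeGp n₂ = ((Subgroup.zpowers δ).map ι).topologicalClosure)
    (hU : G.UnrVerticialSeparatingCoverings) :
    (G.VerticialOpenInterDeterminesVertex ∧ G.EdgeLikeOpenInterDeterminesEdge ∧
      G.UnrVerticialOpenInterDeterminesVertex) ∧
    (G.VerticialEdgeLikeCommensurablyTerminal ∧ G.UnrVerticialCommensurablyTerminal) :=
  G.prop12_of_separating (G.separatingCoverings_of_twoNodeCycle_of_unr hne hprime ι hι hm hm1 hs1 hsr e hC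
    v₀ v₁ hV n₁ n₂ hN δ hδ hV₀ hV₁ hE₁ hE₂ hU)

/-- **[CombGC] Prop. 1.2 (i) and (ii) IN FULL, hypothesis-free, at every NON-STURDY two-node-cycle datum**
(one of the two components of genus `≤ 1`, where the unramified conjunct F-2828 is vacuous).
[cite: MochizukiCombGC2007, Prop 1.2 pp.8-9] -/
theorem prop12_of_twoNodeCycle_of_not_isSturdy (hne : Sigma.Nonempty)
    (hprime : ∀ p ∈ Sigma, p.Prime) (ι : PuncturedSurfaceGroup g r →* P)
    (hι : IsProSigmaCompletion Sigma ι) (G : PSCDatum P) (hG : ¬ G.IsSturdy) {m s : ℕ} (hm : m + 2 ≤ g)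
    (hm1 : 1 ≤ m) (hs1 : 1 ≤ s) (hsr : s + 1 ≤ r)
    (e : G.graph.C ≃ Fin r)
    (hC : ∀ c', G.cuspGp c' = ((cuspInertia (g := g) (e c')).map ι).topologicalClosure)
    (v₀ v₁ : G.graph.V) (hV : ∀ w, w = v₀ ∨ w = v₁)
    (n₁ n₂ : G.graph.N) (hN : ∀ n, n = n₁ ∨ n = n₂) (δ : PuncturedSurfaceGroup g r)
    (hδ : δ = (((List.finRange r).map fun j : Fin r =>
        if (j : ℕ) < s then PuncturedSurfaceGroup.c (g := g) j else 1).prod)⁻¹ *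
      (((List.finRange g).map fun i : Fin g => if m + 1 ≤ (i : ℕ) then
        PuncturedSurfaceGroup.a (r := r) i * PuncturedSurfaceGroup.b i *
          (PuncturedSurfaceGroup.a i)⁻¹ * (PuncturedSurfaceGroup.b i)⁻¹ else 1).prod)⁻¹ *
      PuncturedSurfaceGroup.b ⟨m, by omega⟩)
    (hV₀ : G.vertGp v₀ = ((Subgroup.closure {x : PuncturedSurfaceGroup g r |
        (∃ i : Fin g, (i : ℕ) < m ∧ (x = PuncturedSurfaceGroup.a i ∨ x = PuncturedSurfaceGroup.b i)) ∨
        (∃ j : Fin r, s ≤ (j : ℕ) ∧ x = PuncturedSurfaceGroup.c j) ∨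
        x = PuncturedSurfaceGroup.a ⟨m, by omega⟩ * PuncturedSurfaceGroup.b ⟨m, by omega⟩ *
          (PuncturedSurfaceGroup.a ⟨m, by omega⟩)⁻¹ ∨ x = δ}).map ι).topologicalClosure)
    (hV₁ : G.vertGp v₁ = ((Subgroup.closure {x : PuncturedSurfaceGroup g r |
        (∃ i : Fin g, m < (i : ℕ) ∧ (x = PuncturedSurfaceGroup.a i ∨ x = PuncturedSurfaceGroup.b i)) ∨
        (∃ j : Fin r, (j : ℕ) < s ∧ x = PuncturedSurfaceGroup.c j) ∨
        x = PuncturedSurfaceGroup.b ⟨m, by omega⟩ ∨ x = δ}).map ι).topologicalClosure)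
    (hE₁ : G.nodeGp n₁ = ((Subgroup.zpowers (PuncturedSurfaceGroup.b (r := r) ⟨m, by omega⟩)).map
      ι).topologicalClosure)
    (hE₂ : G.nodeGp n₂ = ((Subgroup.zpowers δ).map ι).topologicalClosure) :
    (G.VerticialOpenInterDeterminesVertex ∧ G.EdgeLikeOpenInterDeterminesEdge ∧
      G.UnrVerticialOpenInterDeterminesVertex) ∧
    (G.VerticialEdgeLikeCommensurablyTerminal ∧ G.UnrVerticialCommensurablyTerminal) :=
  G.prop12_of_twoNodeCycle_of_unr hne hprime ι hι hm hm1 hs1 hsr e hC v₀ v₁ hV n₁ n₂ hN δ hδ hV₀ hV₁ hE₁ hE₂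
    (G.unrVerticialSeparatingCoverings_of_not_isSturdy hG)

/-- **F-0438 first clause (`VerticialEdgeLikeCommensurablyTerminal`) and the edge-like case of F-0459
(`EdgeLikeOpenInterDeterminesEdge`), hypothesis-free, at EVERY two-node-cycle datum** — from F-2826
(companion file) and F-2827 (above) by w5-d183's reductions. [cite: MochizukiCombGC2007, Prop 1.2 pp.8-9] -/
theorem verticialEdgeLikeRows_of_twoNodeCycle (hne : Sigma.Nonempty)
    (hprime : ∀ p ∈ Sigma, p.Prime) (ι : PuncturedSurfaceGroup g r →* P)
    (hι : IsProSigmaCompletion Sigma ι) (G : PSCDatum P) {m s : ℕ} (hm : m + 2 ≤ g) (hm1 : 1 ≤ m)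
    (hs1 : 1 ≤ s) (hsr : s + 1 ≤ r)
    (e : G.graph.C ≃ Fin r)
    (hC : ∀ c', G.cuspGp c' = ((cuspInertia (g := g) (e c')).map ι).topologicalClosure)
    (v₀ v₁ : G.graph.V) (hV : ∀ w, w = v₀ ∨ w = v₁)
    (n₁ n₂ : G.graph.N) (hN : ∀ n, n = n₁ ∨ n = n₂) (δ : PuncturedSurfaceGroup g r)
    (hδ : δ = (((List.finRange r).map fun j : Fin r =>
        if (j : ℕ) < s then PuncturedSurfaceGroup.c (g := g) j else 1).prod)⁻¹ *
      (((List.finRange g).map fun i : Fin g => if m + 1 ≤ (i : ℕ) then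
        PuncturedSurfaceGroup.a (r := r) i * PuncturedSurfaceGroup.b i *
          (PuncturedSurfaceGroup.a i)⁻¹ * (PuncturedSurfaceGroup.b i)⁻¹ else 1).prod)⁻¹ *
      PuncturedSurfaceGroup.b ⟨m, by omega⟩)
    (hV₀ : G.vertGp v₀ = ((Subgroup.closure {x : PuncturedSurfaceGroup g r |
        (∃ i : Fin g, (i : ℕ) < m ∧ (x = PuncturedSurfaceGroup.a i ∨ x = PuncturedSurfaceGroup.b i)) ∨
        (∃ j : Fin r, s ≤ (j : ℕ) ∧ x = PuncturedSurfaceGroup.c j) ∨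
        x = PuncturedSurfaceGroup.a ⟨m, by omega⟩ * PuncturedSurfaceGroup.b ⟨m, by omega⟩ *
          (PuncturedSurfaceGroup.a ⟨m, by omega⟩)⁻¹ ∨ x = δ}).map ι).topologicalClosure)
    (hV₁ : G.vertGp v₁ = ((Subgroup.closure {x : PuncturedSurfaceGroup g r |
        (∃ i : Fin g, m < (i : ℕ) ∧ (x = PuncturedSurfaceGroup.a i ∨ x = PuncturedSurfaceGroup.b i)) ∨
        (∃ j : Fin r, (j : ℕ) < s ∧ x = PuncturedSurfaceGroup.c j) ∨
        x = PuncturedSurfaceGroup.b ⟨m, by omega⟩ ∨ x = δ}).map ι).topologicalClosure)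
    (hE₁ : G.nodeGp n₁ = ((Subgroup.zpowers (PuncturedSurfaceGroup.b (r := r) ⟨m, by omega⟩)).map
      ι).topologicalClosure)
    (hE₂ : G.nodeGp n₂ = ((Subgroup.zpowers δ).map ι).topologicalClosure) :
    G.VerticialEdgeLikeCommensurablyTerminal ∧ G.EdgeLikeOpenInterDeterminesEdge :=
  have hE := G.edgeLikeSeparatingCoverings_of_twoNodeCycle hne hprime ι hι hm hs1 hsr e hC n₁ n₂ hN δ hδ hE₁ hE₂
  ⟨G.verticialEdgeLikeCommensurablyTerminal_of_separating
      (G.verticialSeparatingCoverings_of_twoNodeCycle hne hprime ι hι hm hm1 hs1 hsr v₀ v₁ hV δ hδ hV₀ hV₁) hE,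
    G.edgeLikeOpenInterDeterminesEdge_of_separating hE⟩

end Datum

end PSCDatum

end Literature.AnabelianGeometry.SemiGraphs
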